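import Mathlib
import Summits.ValiantsHypothesis.ValiantsHypothesis.Theorems.BarrierLeverPartitionMinorsHitByVPHiddenStatesCoreLiftCells

/-!
# Route BarrierLever — item `PartitionMinorsHitByVP` (stmt-ValiantsHypothesis-19717), line `hidden-states`:
# THE DIAGONAL REDUCTION — the top window of the lower node, for all `h`, follows from the DIAGONAL cells `(c − 1, 2^{c−1} − c)`

Helper file (`--supports stmt-ValiantsHypothesis-19717`; cell valiant-natproofs, rung V4, 𝒟-side door (c), registered line
`Cruxes/PartitionMinorsHitByVP/Lines/hidden_states.lean` v7; prover seat val-np-p6 gen 12). Definition-free; closes NO item.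

The core lift (`CoreLift.universalJoinWideLower_lift`, p625816) carries a lower cell `(h₀, 2^{h₀} − c)` to every `h ≥ h₀` as long as
`c ≤ h₀ + 1`. The cheapest base is the DIAGONAL CELL `D_c := (c − 1, 2^{c−1} − c)`: ONE legal wide design at level `c − 1` serving every
down-set of co-size `c` there (= co-size `h + 1` at level `h`). `universalJoinWideLower_of_diagonal`: if `D_c` holds for every
`2 ≤ c ≤ C`, then the body of `LowerNode.Stmt.universalJoinWideLower` (p599518) holds at `(h, 2^h − c)` for every `h` and every
`2 ≤ c ≤ min(C, h + 1)` — the LINEAR WINDOW is exactly the family of diagonal cells. `diagonal_le_nineteen`: `D_c` holds for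
`2 ≤ c ≤ 19` (all-`u` designs of `HubWide.universalJoinWide_upto_eighteen`). The first open diagonal cell is `D_20 = (19, 2^19 − 20)`,
the top of the open `h = 19` window `517 159 ≤ r ≤ 524 268` (p626621); the column `c = 20` is known only from `h = 20` on (p628612).

WHAT THIS IS NOT: a reduction, not a cell; at the diagonal no design containing an affine `(h−1)`-cube can serve the ball `B_{h−2}([h])`
(degree obstruction), so the flag/tilt designs do not apply there; nothing on crux 14610 or VP ≠ VNP.
-/

set_option linter.dupNamespace false

namespace Summit.ValiantsHypothesis.ValiantsHypothesis.Theorems.BarrierLever.HiddenStates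

open Finset Matrix MvPolynomial

noncomputable section

namespace CoreLift

/-- **THE DIAGONAL REDUCTION.** If the diagonal cells `(c − 1, 2^{c−1} − c)` hold for all `2 ≤ c ≤ C`, then the lower node holds at
`(h, 2^h − c)` for every `h` and every `2 ≤ c ≤ min(C, h + 1)`. -/
theorem universalJoinWideLower_of_diagonal (C : ℕ)
    (hdiag : ∀ c : ℕ, 2 ≤ c → c ≤ C →
      ∃ (m K : ℕ) (W : Fin m → ℕ) (wt : Fin m → Fin K → ℕ) (e : Fin (2 ^ (c - 1) - c) → Fin m × Finset (Fin K)),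
        m ≤ (c - 1) + (c - 1) ∧ K ≤ (c - 1) * (c - 1) * (c - 1) ∧ Function.Injective e ∧
        (∀ x : Fin m × Finset (Fin K), x ∉ Set.range e →
          ∀ i, W (e i).1 + ∑ k ∈ (e i).2, wt (e i).1 k < W x.1 + ∑ k ∈ x.2, wt x.1 k) ∧
        ∀ u : Fin (2 ^ (c - 1) - c) → Finset (Fin (c - 1)), Function.Injective u → IsLowerSet (Set.range u) →
          ∃ tx : Fin m → Option (Fin K) → Fin (c - 1) → ℂ,
            (Matrix.of fun i k : Fin (2 ^ (c - 1) - c) =>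
              ∏ a ∈ u i, (tx (e k).1 none a + ∑ q ∈ (e k).2, tx (e k).1 (some q) a)).det ≠ 0)
    (h c : ℕ) (h2 : 2 ≤ c) (hcC : c ≤ C) (hch : c ≤ h + 1) :
    ∃ (m K : ℕ) (W : Fin m → ℕ) (wt : Fin m → Fin K → ℕ) (e : Fin (2 ^ h - c) → Fin m × Finset (Fin K)),
      m ≤ h + h ∧ K ≤ h * h * h ∧ Function.Injective e ∧
      (∀ x : Fin m × Finset (Fin K), x ∉ Set.range e →
        ∀ i, W (e i).1 + ∑ k ∈ (e i).2, wt (e i).1 k < W x.1 + ∑ k ∈ x.2, wt x.1 k) ∧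
      ∀ u : Fin (2 ^ h - c) → Finset (Fin h), Function.Injective u → IsLowerSet (Set.range u) →
        ∃ tx : Fin m → Option (Fin K) → Fin h → ℂ,
          (Matrix.of fun i k : Fin (2 ^ h - c) =>
            ∏ a ∈ u i, (tx (e k).1 none a + ∑ q ∈ (e k).2, tx (e k).1 (some q) a)).det ≠ 0 := by
  obtain ⟨d, rfl⟩ : ∃ d, h = (c - 1) + d := ⟨h - (c - 1), by omega⟩
  have hpow : c ≤ 2 ^ (c - 1) := by
    have key : ∀ n : ℕ, n + 1 ≤ 2 ^ n := fun n => Nat.lt_two_pow_self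
    have := key (c - 1)
    omega
  exact universalJoinWideLower_lift_iter (c - 1) c (by omega) hpow (hdiag c h2 hcC) d

/-- **The diagonal cells `D_c`, `2 ≤ c ≤ 19`, hold** (all-`u` designs for `h ≤ 18`). -/
theorem diagonal_le_nineteen (c : ℕ) (h2 : 2 ≤ c) (hc : c ≤ 19) :
    ∃ (m K : ℕ) (W : Fin m → ℕ) (wt : Fin m → Fin K → ℕ) (e : Fin (2 ^ (c - 1) - c) → Fin m × Finset (Fin K)),
      m ≤ (c - 1) + (c - 1) ∧ K ≤ (c - 1) * (c - 1) * (c - 1) ∧ Function.Injective e ∧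
      (∀ x : Fin m × Finset (Fin K), x ∉ Set.range e →
        ∀ i, W (e i).1 + ∑ k ∈ (e i).2, wt (e i).1 k < W x.1 + ∑ k ∈ x.2, wt x.1 k) ∧
      ∀ u : Fin (2 ^ (c - 1) - c) → Finset (Fin (c - 1)), Function.Injective u → IsLowerSet (Set.range u) →
        ∃ tx : Fin m → Option (Fin K) → Fin (c - 1) → ℂ,
          (Matrix.of fun i k : Fin (2 ^ (c - 1) - c) =>
            ∏ a ∈ u i, (tx (e k).1 none a + ∑ q ∈ (e k).2, tx (e k).1 (some q) a)).det ≠ 0 := by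
  obtain ⟨m, K, W, wt, e, hm, hK, he, hthr, hgood⟩ :=
    HubWide.universalJoinWide_upto_eighteen (c - 1) (by omega) (by omega) (2 ^ (c - 1) - c) (Nat.sub_le _ _)
  exact ⟨m, K, W, wt, e, hm, hK, he, hthr, fun u hu _ => hgood u hu⟩

/-- The first open diagonal cell is `D_20 = (19, 2^19 − 20)`, the top of the open `h = 19` window. -/
theorem first_open_diagonal : 2 ^ 19 - 20 = 524268 := by norm_num

end CoreLift

end

end Summit.ValiantsHypothesis.ValiantsHypothesis.Theorems.BarrierLever.HiddenStates
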